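import Mathlib
import Summits.Ventures.PercRepro2.V2ParallelClosure
import Summits.Ventures.PercRepro2.V2SP
import Summits.Ventures.PercRepro2.HallOffFrame

/-!
# The Hall (monotone-relay) form of the axis family, every `k`, on every series–parallel network
(seat mine-b, cell pub-perc-repro2; MINE-B.md §36.3)

For every pattern `s` of the cell's grammar and every `a ≥ 1`, `HallFn (phi a 0) s.rLab s.bLab`: every
upper set `U` of the configuration poset (red < blue on the free edges) satisfies

  `#(U ∩ {r = a−1, b ≥ 1}) ≥ #(U ∩ {r ≥ a, b = 0})`,

i.e. by Hall's theorem there is an injection from `{r ≥ a, b = 0}` into `{r = a−1, b ≥ 1}` that only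
recolours red edges blue — the monotone relay behind `tail_axis_unimodal` (`T(a,0) ≤ T(a−1,1)`), which is
the upper set `univ` (`hallFn_phi_axis_count`).  The member `a = 1` is the Harris condition `HarrisCond`
of `V2ParallelClosure.lean` (`harrisCond_iff_hallFn`).

PROOF by induction over the grammar, all `a` at once.  Series: `hallFn_phi_ser`.  Parallel: the pointwise
identity (`phi_par_axis_eq`, flows add)

  `phi a 0 (r+r′) (b+b′) = [r′+2 ≤ a ∧ b′ = 0]·phi (a−r′) 0 r b + [r′+2 ≤ a ∧ b′ ≥ 1 ∧ r+r′+1 = a]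
                           + [r′+1 = a]·phi 1 0 r b + [b = 0]·phi a 0 r′ b′`,

whose four terms are, on any upper set of the product, a sum over `k ≤ a−2` of (Hall weight of `X`) ×
(non-negative weight of `Y`), a non-negative term, (Hall weight of `X`) × (weight of `Y`), and
(weight of `X`) × (Hall weight of `Y`) — the fibre lemmas of `HallOffFrame.lean`.
-/

namespace Summit.Ventures.PercRepro2.V2Closure

open Finset

variable {X Y : Type*}

/-- The pointwise identity of the parallel step for the axis weights. -/
theorem phi_par_axis_eq (a r b r' b' : ℕ) :
    phi a 0 (r + r') (b + b')
      = (if r' + 2 ≤ a ∧ b' = 0 then phi (a - r') 0 r b else 0)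
        + (if r' + 2 ≤ a ∧ 1 ≤ b' ∧ r + r' + 1 = a then (1 : ℤ) else 0)
        + (if r' + 1 = a then phi 1 0 r b else 0)
        + (if b = 0 then phi a 0 r' b' else 0) := by
  rcases (by omega : r' + 2 ≤ a ∨ r' + 1 = a ∨ a ≤ r') with h1 | h1 | h1 <;>
  rcases (by omega : b' = 0 ∨ 1 ≤ b') with h2 | h2 <;>
  rcases (by omega : b = 0 ∨ 1 ≤ b) with h3 | h3 <;>
  simp (disch := omega) only [if_pos, if_neg] <;>
  unfold phi <;>
  split_ifs <;> omega

/-- The first term of `phi_par_axis_eq`, as a sum over `k ≤ a − 2` of (Hall weight of `x`) × (weight of `y`). -/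
theorem axis_first_term_eq (a r b r' b' : ℕ) :
    (if r' + 2 ≤ a ∧ b' = 0 then phi (a - r') 0 r b else 0)
      = ∑ k ∈ Finset.range (a - 1), phi (a - k) 0 r b * (if r' = k ∧ b' = 0 then (1 : ℤ) else 0) := by
  by_cases h : r' + 2 ≤ a ∧ b' = 0
  · rw [if_pos h]
    rw [Finset.sum_eq_single r']
    · simp [h.2]
    · intro k _ hk
      simp [Ne.symm hk]
    · intro hr
      exfalso; apply hr
      simp only [Finset.mem_range]; omega
  · rw [if_neg h]
    symm
    apply Finset.sum_eq_zero
    intro k hk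
    simp only [Finset.mem_range] at hk
    split_ifs with h2
    · exfalso; apply h; constructor <;> omega
    · simp

/-- The axis weights `phi k 0`, `1 ≤ k ≤ a`, are Hall on `X` and on `Y` ⟹ `phi a 0` is Hall on the parallel
composition (sums of the labels). -/
theorem hallFn_phi_axis_par [Preorder X] [Preorder Y] [Fintype X] [Fintype Y] [DecidableEq X] [DecidableEq Y]
    (a : ℕ) (ha : 1 ≤ a) (r b : X → ℕ) (r' b' : Y → ℕ)
    (hX : ∀ k, 1 ≤ k → k ≤ a → HallFn (phi k 0) r b) (hY : HallFn (phi a 0) r' b') :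
    HallFn (phi a 0) (parR r r') (parB b b') := by
  intro W hW
  have e : ∑ p ∈ W, phi a 0 (parR r r' p) (parB b b' p)
      = ∑ p ∈ W, (∑ k ∈ Finset.range (a - 1), phi (a - k) 0 (r p.1) (b p.1) * (if r' p.2 = k ∧ b' p.2 = 0 then (1 : ℤ) else 0))
        + ∑ p ∈ W, (if r' p.2 + 2 ≤ a ∧ 1 ≤ b' p.2 ∧ r p.1 + r' p.2 + 1 = a then (1 : ℤ) else 0)
        + ∑ p ∈ W, phi 1 0 (r p.1) (b p.1) * (if r' p.2 + 1 = a then (1 : ℤ) else 0)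
        + ∑ p ∈ W, (if b p.1 = 0 then (1 : ℤ) else 0) * phi a 0 (r' p.2) (b' p.2) := by
    rw [← Finset.sum_add_distrib, ← Finset.sum_add_distrib, ← Finset.sum_add_distrib]
    apply Finset.sum_congr rfl
    intro p _
    unfold parR parB
    rw [phi_par_axis_eq a (r p.1) (b p.1) (r' p.2) (b' p.2), axis_first_term_eq]
    split_ifs <;> ring
  rw [e]
  apply add_nonneg (add_nonneg (add_nonneg ?_ ?_) ?_) ?_
  · rw [Finset.sum_comm]
    apply Finset.sum_nonneg
    intro k hk
    simp only [Finset.mem_range] at hk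
    exact sum_hall_mul_nonneg_fst (hX (a - k) (by omega) (by omega)) r' b'
      (fun u v => if u = k ∧ v = 0 then 1 else 0) (fun u v => by split_ifs <;> simp) W hW
  · apply Finset.sum_nonneg
    intro p _
    split_ifs <;> simp
  · exact sum_hall_mul_nonneg_fst (hX 1 le_rfl ha) r' b' (fun u _ => if u + 1 = a then 1 else 0)
      (fun u v => by split_ifs <;> simp) W hW
  · exact sum_mul_hall_nonneg_snd r b hY (fun _ v => if v = 0 then 1 else 0)
      (fun u v => by split_ifs <;> simp) W hW

/-- **The Hall form of the whole axis family holds on every series–parallel pattern**: for every `a ≥ 1`,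
every upper set of the configuration poset contains at least as many configurations with `r = a−1, b ≥ 1` as
with `r ≥ a, b = 0`. -/
theorem SP.hallFn_phi_axis : ∀ (s : SP) (a : ℕ), 1 ≤ a → HallFn (phi a 0) s.rLab s.bLab
  | .free, a, ha => Atoms.hallFn_phi_free a 0 ha
  | .pin, a, ha => Atoms.hallFn_phi_pin a 0 ha
  | .absent, a, ha => Atoms.hallFn_phi_absent a 0 ha
  | .ser s t, a, ha => hallFn_phi_ser a 0 s.rLab s.bLab t.rLab t.bLab
      (SP.hallFn_phi_axis s a ha) (SP.hallFn_phi_axis t a ha)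
  | .par s t, a, ha => hallFn_phi_axis_par a ha s.rLab s.bLab t.rLab t.bLab
      (fun k hk _ => SP.hallFn_phi_axis s k hk) (SP.hallFn_phi_axis t a ha)

/-- The count behind it (the upper set `univ`): `Σ phi a 0 ≥ 0`, i.e. `T(a,0) ≤ T(a−1,1)`. -/
theorem SP.hallFn_phi_axis_count (s : SP) (a : ℕ) (ha : 1 ≤ a) :
    0 ≤ ∑ x, phi a 0 (s.rLab x) (s.bLab x) :=
  (SP.hallFn_phi_axis s a ha).sum_univ_nonneg

/-- The member `a = 1` is the Harris condition of `V2ParallelClosure.lean`. -/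
theorem harrisCond_iff_hallFn [Preorder X] (r b : X → ℕ) : HarrisCond r b ↔ HallFn (phi 1 0) r b := by
  constructor
  · intro h V hV
    have := h V hV
    have e : ∑ x ∈ V, phi 1 0 (r x) (b x)
        = ∑ x ∈ V, (if r x = 0 then (1 : ℤ) else 0) - ∑ x ∈ V, (if b x = 0 then (1 : ℤ) else 0) := by
      rw [← Finset.sum_sub_distrib]
      apply Finset.sum_congr rfl
      intro x _
      unfold phi; split_ifs <;> omega
    rw [e]; linarith
  · intro h V hV
    have := h V hV
    have e : ∑ x ∈ V, phi 1 0 (r x) (b x)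
        = ∑ x ∈ V, (if r x = 0 then (1 : ℤ) else 0) - ∑ x ∈ V, (if b x = 0 then (1 : ℤ) else 0) := by
      rw [← Finset.sum_sub_distrib]
      apply Finset.sum_congr rfl
      intro x _
      unfold phi; split_ifs <;> omega
    rw [e] at this; linarith

end Summit.Ventures.PercRepro2.V2Closure
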